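import Summits.QuantumFields.YangMills.Theorems.BalabanUVNodesN19RateEdgeHolderAtRecord13CoPH
import Summits.QuantumFields.YangMills.Theorems.BalabanUVNodesN19RateEdgeRecordRunLetters
import Summits.QuantumFields.YangMills.Theorems.BalabanUVNodesSpineReadingOfRecord13CoPH

/-!
# BalabanUVNodes ∕ N19 — K3⁷ v2's N19′ SLOT `KeyedCoreEdgeHolderD4 β cr (rrOfRecord 𝔯 ksel)` BY NAME MODULO A SHORTER LINK READING: the (D4)
# read-out, node U3's rate letter `ρ < 1`, the three letter signs, the radius sign, the block factor `2 ≤ L` and (T)'s window clause DISCHARGED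
# from the slot's own hypothesis `PHolderD4`, admissibility and the family (dag-n19-w3's letters BY NAME)

Cell `pub-ymgap`, HUMAN RULING D-0062 (Track A) + D-0149 (work-bound push, director-ym №197), R134 ACCELERATION seat `pub-ymgap-dag-n19-d`
(N19 NE7, strategy s2 = by-name knit at the record), generation g23; bus INTENT-J (pub-ymgap INBOX l.25428).  Route
`Summits/QuantumFields/YangMills/Theses/BalabanUVNodes.lean` rev 25, cluster item K3⁷ «SpineGivenEndpointR13SepCoPH» (stmt-QuantumFields-20544), plan g79's
registered skeleton v2 145a664ea9c38a7b (stubs `stub_rates13H` ∕ `stub_expansion13H`; N19′'s slot `KeyedCoreEdgeHolderD4 β cr (rrOfRecord 𝔯 ksel)` at the rates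
predicate `PHolderD4 β D R := RatesHolderAt D R β ∧ ReadOutAt D R.u3 ∧ (0 ≤ R.u3.ρ ∧ R.u3.ρ < 1)`); filed `--kind proof --supports` that item `--as helper` (it proves
no registered stub: the N19′ conjunct of stub 2 modulo the displayed link reading).  COUNT-NEUTRAL.  THEOREMS ONLY; 0 `def`; 0 `sorry`; `N`-generic, guard-generic
`G`, reading-generic `cr`; NO Theses import.  Imports F `…N19RateEdgeHolderAtRecord13CoPH` (p583345; brings E `rateEdge_of_linkReading_byName_pairDiscC1Holder`),
dag-n19-w3's `…N19RateEdgeRecordRunLetters` (p586569: the letters of the ₁₃ rate-record bundle BY NAME) and dag-n20-d's `…SpineReadingOfRecord13CoPH` (p587226) — CITED BY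
NAME, none edited.

WHAT THIS FILE PROVES (`R := rateCarriersOfRecord₁₃CoPH 𝔯 F θ hP g₀ os k`, `D := datumOfRecord₁₃CoPH F N θ hP`, `S := cr F θ hP g₀ os`).
* ★★ `h19HolderD4_datumOfRecord₁₃CoPH_of_linkReading` — IF the SHORTER link reading `hlink` holds at the record tuples THEN at every guarded admissible tuple, every
  `g₀ os k`: `RatesHolderAt D R β ∧ ReadOutAt D R.u3 ∧ (0 ≤ R.u3.ρ ∧ R.u3.ρ < 1) → ∃ δ, NE7.Core S.l₀ S.vol S.T S.Bad (S.A − S.shA) (S.B − S.shB) δ ∧ Summable δ`.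
  The shorter `hlink` is F's θ-keyed «v9» ∃-clause (`N19RateEdgeHolderAtRecord13CoPH` l.94–233) with EIGHT edits, every removed conjunct DISCHARGED BY NAME in the proof:
  (1) `ReadOutAt D R.u3` removed — it is the slot's `PHolderD4` conjunct; (2) `R.u3.ρ < 1` removed — likewise; (3)–(5) the letter signs `0 ≤ R.u3.θ ∧ 0 ≤ R.u3.C₅ ∧
  0 ≤ R.u3.ω` removed — `signs_rateCarriersOfRecord₁₃CoPH_of_readOutAt` (dag-n19-w3 §4) from (1); (6) `0 < R.u3.γ` removed — `gamma_pos_rateCarriersOfRecord₁₃CoPH`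
  (§6; `R.u3.γ = θ.γ`, admissibility); (7) `2 ≤ R.ne3.L` removed — `two_le_ne3_L_rateCarriersOfRecord₁₃CoPH` (§3; the family's block factor); (8) (T)'s window clause
  `∀ s ∈ R.u3.W, ∀ j, 0 < s j ∧ s j ^ 2 ≤ e⁻¹` REPLACED by the tuple letter `θ.γ ^ 2 ≤ Real.exp (-1)` (§5 `window_rateCarriersOfRecord₁₃CoPH_sq_le_exp_neg_one`;
  `R.u3.W = Window θ.γ` by `rfl`).  Proof: E at the SAME-TUPLE pair predicate `PRec F D g₀ os S R := ∃ θ hP k, G θ ∧ θ.Admissible ∧ D = … ∧ S = cr … ∧ R = … ∧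
  ReadOutAt D R.u3 ∧ R.u3.ρ < 1` (the slot's two conjuncts ride INSIDE the predicate); E's `hlink` obligation at such tuples = v9's clause REASSEMBLED from the shorter
  reading (staged `obtain`s, as E) and the seven named facts, in v9's conjunct order.
* ★★ `keyedCoreEdgeHolderD4_of_linkReading` — the same at `k := ks F θ hP g₀ os` for a run-length selector `ks`: at `N = 2`, `G := θ.ZhUnity F 2 ∧ θ.SlotsNondegenerate₁₃ F 2`
  this is LITERALLY the v2 slot `KeyedCoreEdgeHolderD4 β cr (rrOfRecord 𝔯 ks)` unfolded (`rrOfRecord 𝔯 ks F θ hP g₀ os := rateCarriersOfRecord₁₃CoPH 𝔯 F θ hP g₀ os (ks …)`,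
  `PHolderD4` as above — plain `def`s local to the skeleton), for ANY spine reading `cr` — in particular at dag-n20-d's `crOfRecord₁₃At K₀ jcut sh` ∕ `crOfRecord₁₃ jcut sh`
  (the `PinnedAtLive` witness) by unification; the sibling H (p587439) gives the reading's OWN canonical `δ` there.
So N19's displayed residual AT THE v2 SLOT is the shorter reading: NODE O's ledger world (i)∕(ii-m)∕(ii-v-A∕B)∕(ii-d), [III] Thm 2 (2.43) window letters (N11), N14's
positional count, the (v′-16) N16 letters (regime numerics of `R.ne3`, N07's `LeafH3sup`, selection, readings, `hdomC1`, floor `θ^{3β−2} ≤ θ₃`), (v′-17)'s run letters ∕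
infrared pin ∕ `EventualLowerH` ∕ smallness ∕ `0 < ρ` ∕ `ρ ≤ θc` ∕ box, (T)'s `DecayBound` ∕ pair discs ∕ constants ∕ upper running ∕ windows ∕ selector, and `θ.γ² ≤ e⁻¹`.
(The run letters are dag-n19-w3's theorems on the TUNED prefix only — `forSmallCouplings_runLetters_datumOfRecord₁₃CoPH`; v2's slots quantify over every `g₀`, so
they stay displayed here: a located design point for a later skeleton edition, bus l.25428.)

HONEST FRAMING.  Count-neutral kernel bookkeeping (one reassembly + one application); `hlink` is a HYPOTHESIS (NODE O's world, K2⁷; 0 instances in the tree); the rates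
predicate is the slot's own hypothesis; `cr 𝔯 G ks` PARAMETERS.  NOT a proof of `stub_expansion13H` (its N20 ∕ N21 ∕ N27x ∕ `PinnedAtLive` conjuncts are other lanes').
NE7 for Bałaban's two runs is NOT PRINTED and NOT proved; nothing of Bałaban's is asserted or instantiated (K0⁷ OPEN); N19 NOT discharged; K3⁷ NOT claimed; Track A
count unmoved (typed 28∕28 · discharged 5∕27 · A 5∕28).  One finite four-torus at fixed ε, rung (B)+1 — NOT infinite volume, NOT OS on ℝ⁴, NOT a mass gap, NOT Clay.
Standard axioms.  Supersedes nothing; edits nothing.  Shape reference: [Balaban1988Convergent] Thm 2 (2.43) p.263 (the NAME of the displayed hypothesis `B14.Thm2Printed` inside `hlink` —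
nothing asserted).
-/

set_option autoImplicit false

noncomputable section

open Finset MeasureTheory
open scoped BigOperators Matrix Matrix.Norms.L2Operator

namespace Summit.QuantumFields.YangMills.BalabanUVNodes.N19RateEdgeHolderD4

open Literature.MathematicalPhysics.QuantumFieldTheory.Balaban1983to89
open T4OutputRate T4RecentScale T4GoodClassBudget T4CauchySum T4TowerRateComposition T4TowerRateDischarge
open T4EtaRateMin (Readings NE3Shape)
open T4RateLiaison (GaugeDominated)
open T4CouplingMatching (EventualLowerH)
open FlowStep (RGEqH)
open TreeLengthTorus (TFaceConnected torusTreeLen)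
open B12TreeDecay (kappa₀)
open Summit.QuantumFields.BalabanUV.T4Continuum
open AveragingDeficitDualResidual (dualC1 dualC2)
open AveragingDeficitDerivWallProof (wallConst)
open AveragingDeficitPeriodicCounting (IsPeriodicDir)
open MinimalActionSandwich (IsMinimiser minAct)
open MinimalActionRate (sfClass)
open MinimalActionRefine (RegularSup gradConst)
open NE3EnergyShapes (IsUnitarySite IsPeriodicSite)
open NE3.LeafIndexSockets (LeafH3sup)
open Summit.QuantumFields.BalabanUV.T4Continuum.Spine
open Summit.QuantumFields.BalabanUV.T4Continuum.NE1p.DressedRoot (DressedTower DressedStabilityStrict)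
open Summit.QuantumFields.YangMills.BalabanUVNodes.N19LedgerLinkSync (LedgerDataSync LedgerAtSync)
open YMDAG.UVSplit (SpineCarriers SpineRecordPred InputsPred U3Carriers RateCarriers RateRecordPred N14At N18At N22At ReadOutAt)
open Summit.QuantumFields.YangMills.BalabanUVNodes.N16HolderDefs (CovRootHolder N16HolderAt)
open Summit.QuantumFields.YangMills.BalabanUVNodes.SpineRatesHolder (RatesHolderAt)
open Literature.MathematicalPhysics.QuantumFieldTheory.Balaban1983to89.T4Continuum (T4Family ULoop)
open T4WeightBudget (RelWeightBound)
open T4IndicatorShell (ShellWeightBound)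
open T4ContinuumYM4Torus (ForSmallCouplings)
open T4ApexHybrid (HybridNE7Under)
open YMDAG.UVSplit (Datum RateReading₁₃CoPH rateCarriersOfRecord₁₃CoPH)
open YMDAG.UVSplit (SpineReading₁₃CoPH ShellSplit₁₃CoPH crOfRecord₁₃At classSet₁₃ weightA₁₃ weightB₁₃ badClass₁₃ core_crOfRecord₁₃At)
open Node00 (Stage13HParams datumOfRecord₁₃CoPH SiteSeqKey)
open Summit.QuantumFields.YangMills.BalabanUVNodes.SpineCanonicalWeights (core_nonneg_of_shellWeightBound)
open Summit.QuantumFields.YangMills.BalabanUVNodes.N19RateEdgeHolder (rateEdge_of_linkReading_byName_pairDiscC1Holder)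
open Summit.QuantumFields.YangMills.BalabanUVNodes.N19RateEdgeRecordRunLetters
  (two_le_ne3_L_rateCarriersOfRecord₁₃CoPH signs_rateCarriersOfRecord₁₃CoPH_of_readOutAt window_rateCarriersOfRecord₁₃CoPH_sq_le_exp_neg_one
    gamma_pos_rateCarriersOfRecord₁₃CoPH)

/-! ## §1 The SHORTER link reading at the record tuples ⇒ N19′'s edge GIVEN `PHolderD4 β` (R-β rates ∧ (D4) ∧ `0 ≤ ρ < 1`) -/

section AtRecordD4

variable {N : ℕ} [NeZero N]
  (cr : (F : T4Family) → (θ : Stage13HParams F N) → θ.Provisos₁₃CoPH F N → (ℕ → ℝ) → List (ULoop F) → SpineCarriers)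
  (𝔯 : RateReading₁₃CoPH N) (G : ∀ {F : T4Family}, Stage13HParams F N → Prop) {β : ℝ} (hβ1 : β ≤ 1)
  (hlink : ∀ (F : T4Family) (θ : Stage13HParams F N) (hP : θ.Provisos₁₃CoPH F N), G θ → θ.Admissible F N →
    ∀ (g₀ : ℕ → ℝ) (os : List (ULoop F)) (k : ℕ),
      let S : SpineCarriers := cr F θ hP g₀ os
      let R : RateCarriers N := rateCarriersOfRecord₁₃CoPH 𝔯 F θ hP g₀ os k
      let D : Datum F N := datumOfRecord₁₃CoPH F N θ hP
      letI := S.dec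
      -- the tuple's window letter (replaces (T)'s clause over `R.u3.W`; dag-n19-w3 `window_rateCarriersOfRecord₁₃CoPH_sq_le_exp_neg_one`)
      θ.γ ^ 2 ≤ Real.exp (-1) ∧
      ∃ (_ : DecidableEq R.u3.C.Dom) (F' : Type) (ι' X' : Type) (_ : MeasurableSpace ι')
        (L : LedgerDataSync R.u3.C F' ι' S.ι) (Rd : Readings ι' X') (bsel : (ℕ → ℝ) → ℝ) (EB : Functional R.u3.C R.u3.C.BgB)
        (θc θ₃ : ℝ) (g : ℕ → ℕ → ℝ)
        (uA : ℕ → ι' → R.u3.C.BgA) (uB : ℕ → ι' → R.u3.C.BgB)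
        (Pf : ℕ → Params) (d₀ L₀ Koff : ℕ) (cells : (K j : ℕ) → R.u3.C.Dom → Finset (Site (Pf K) j))
        (H033 : Flow → ℕ → Prop) (I : Type) (fam : I → B14.Sect2Data) (Lb βw : ℝ) (κ₁ : ℕ) (Gv Cl : ℝ) (K₁ : ℕ)
        (Λ₀ N₀ : ℝ) (dressed : R.u3.C.Dom → Prop) (_ : DecidablePred dressed)
        -- N16-side letters: regime, selection, reading map, NE7 route-#1 side letters, offset
        (c' t ε₁ θ γ₃ l₁ : ℝ)
        (sel : ℕ → (B7Prop1Explicit.Site 4 → Fin 4 → (Matrix (Fin N) (Fin N) ℂ)ˣ) → (B7Prop1Explicit.Site 4 → Fin 4 → (Matrix (Fin N) (Fin N) ℂ)ˣ))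
        (rd : ι' → (B7Prop1Explicit.Site 4 → Fin 4 → (Matrix (Fin N) (Fin N) ℂ)ˣ)) (k₀ : ℕ)
        -- N17-side letters: infrared pin, β-window
        (gIR bβ : ℝ) (k₀β : ℕ)
        -- TUBE letters of the bracket (T): the (1.18) constant, the layer factor and (2.28)'s `C₁, q₁`, the flow's `β′`
        (E₀T κ₁T C₁T β'T : ℝ) (q₁ : ℕ),
        -- the run-B functional is the first-coupling family read through the selector
        EB = (fun s => R.u3.EB (bsel s) s) ∧
        -- (i) the ledger predicate for whatever size data and census constants meet their clauses
        (∀ (Sz : ℕ → ℝ → S.ι → ℕ → ℝ) (E₀ : ℝ) (m : ℕ) (a : ℝ) (Cw Λg : ℝ),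
          (∀ K t, |t| ≤ S.l₀ → ∀ τ ∈ S.T K \ S.Bad K t, ∀ v ∈ Rd.dom, ∀ j ≤ K,
            |∑ X ∈ L.fac K t τ with R.u3.C.scale X = j,
                (Real.log (Real.exp (EB (fun i => g (K + 1) (i + 1)) (uB K v) X
                    - EB (fun i => g (K + 1) (i + 1)) L.oneB X))
                  - Real.log (Real.exp (R.u3.EA (g K) (uA K v) X - R.u3.EA (g K) L.oneA X)))| ≤ Sz K t τ j) →
          0 ≤ E₀ → 0 < a → a < 1 →
          (∀ K t, |t| ≤ S.l₀ → ∀ τ ∈ S.T K \ S.Bad K t, ∀ j ≤ K,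
            Sz K t τ j ≤ S.vol * (E₀ * ((K : ℝ) + 1) ^ m * a ^ (K - j))) →
          (∀ K, Multiplicity (L.All K) R.u3.C.scale (fun X => Real.exp (-(R.u3.κ * R.u3.C.d X))) Cw S.vol Λg K) →
          (∀ K t, |t| ≤ S.l₀ → ∀ τ ∈ S.T K \ S.Bad K t,
            WindowMultiplicity (L.facO K t τ) L.scO L.wO Cw S.vol Λg (jlogOf L.Cl K) K) →
          1 ≤ Λg → L.θ' ≤ Λg →
          LedgerAtSync { L with S := Sz, E₀ := E₀, m := m, a := a, Cw := Cw, Λg := Λg } S.l₀ S.vol S.T S.Bad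
            (fun K t τ => S.A K t τ - S.shA K t τ) (fun K t τ => S.B K t τ - S.shB K t τ) Rd R.u3.EA EB R.u3.κ g uA uB
            R.u3.ω θc R.u3.θ θ₃) ∧
        0 ≤ S.vol ∧
        (∀ K t, |t| ≤ S.l₀ → ∀ τ ∈ S.T K \ S.Bad K t,
          WindowMultiplicity (L.facO K t τ) L.scO L.wO L.Cw S.vol L.Λg (jlogOf L.Cl K) K) ∧
        0 ≤ L.Cw ∧ 1 ≤ L.Λg ∧ L.θ' ≤ L.Λg ∧
        -- (ii-m) the reference ledger's lattice identification
        (∀ K, (Pf K).d = d₀) ∧ (∀ K, (Pf K).L = L₀) ∧ (∀ K, (Pf K).K = Koff + K) ∧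
        (∀ K, (Fintype.card (Site (Pf K) (Pf K).K) : ℝ) = S.vol) ∧
        kappa₀ (4 * 2 ^ d₀) (2 * d₀) ≤ R.u3.κ ∧
        (∀ K, ∀ X ∈ L.All K,
          (cells K (R.u3.C.scale X + Koff) X).Nonempty ∧ TFaceConnected (cells K (R.u3.C.scale X + Koff) X)) ∧
        (∀ K j, Set.InjOn (cells K j) ↑((L.All K).filter fun X => R.u3.C.scale X + Koff = j)) ∧
        (∀ K, ∀ X ∈ L.All K, torusTreeLen (cells K (R.u3.C.scale X + Koff) X) ≤ R.u3.C.d X) ∧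
        -- (iii) [III] Theorem 2 (2.43) AS PRINTED with window letters
        B14.Thm2Printed H033 fam Lb βw κ₁ ∧ βw < 1 ∧ 0 < βw ∧ 1 < Lb ∧ 1 ≤ Gv ∧ 0 ≤ Cl ∧
        -- (iv) the positional-count half of N14's pinned pair at a rate `≤ R.ne1.Λ`
        (∀ p K, (R.ne1.𝒯.B p K).PositionalCount fun j k => N₀ * Λ₀ ^ (k - j)) ∧ 0 ≤ N₀ ∧ 0 ≤ Λ₀ ∧ Λ₀ ≤ R.ne1.Λ ∧
        -- (ii-v-A) run A's vacuum slices ↔ printed E-terms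
        (∀ K t, |t| ≤ S.l₀ → ∀ τ ∈ S.T K \ S.Bad K t, ∀ v ∈ Rd.dom, ∀ j ≤ K, ∃ (i : I) (w : (fam i).Ω) (j' : ℕ),
          (fam i).flow.SatisfiesRG (fam i).K ∧ H033 (fam i).flow (fam i).K ∧ 1 ≤ j' ∧ j' ≤ (fam i).K ∧
          (fam i).K - j' = K - j ∧ (fam i).K ≤ K + K₁ ∧
          (∀ n, 0 ≤ (fam i).gammaVol n w) ∧ (fam i).gammaVol (fam i).K w ≤ S.vol ∧
          (∀ n, n < (fam i).K → n < jlogOf Cl (fam i).K → (fam i).gammaVol n w = 0) ∧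
          (∀ n, n < (fam i).K → jlogOf Cl (fam i).K ≤ n → (fam i).gammaVol n w ≤ S.vol * Gv ^ ((fam i).K - n)) ∧
          |∑ X ∈ (L.fac K t τ).filter (fun X => ¬ dressed X) with R.u3.C.scale X = j,
              (R.u3.EA (g K) (uA K v) X - R.u3.EA (g K) L.oneA X)| ≤ |(fam i).eTerm j' (fam i).K w|) ∧
        -- (ii-v-B) run B's vacuum slices ↔ printed E-terms
        (∀ K t, |t| ≤ S.l₀ → ∀ τ ∈ S.T K \ S.Bad K t, ∀ v ∈ Rd.dom, ∀ j ≤ K, ∃ (i : I) (w : (fam i).Ω) (j' : ℕ),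
          (fam i).flow.SatisfiesRG (fam i).K ∧ H033 (fam i).flow (fam i).K ∧ 1 ≤ j' ∧ j' ≤ (fam i).K ∧
          (fam i).K - j' = K - j ∧ (fam i).K ≤ K + K₁ ∧
          (∀ n, 0 ≤ (fam i).gammaVol n w) ∧ (fam i).gammaVol (fam i).K w ≤ S.vol ∧
          (∀ n, n < (fam i).K → n < jlogOf Cl (fam i).K → (fam i).gammaVol n w = 0) ∧
          (∀ n, n < (fam i).K → jlogOf Cl (fam i).K ≤ n → (fam i).gammaVol n w ≤ S.vol * Gv ^ ((fam i).K - n)) ∧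
          |∑ X ∈ (L.fac K t τ).filter (fun X => ¬ dressed X) with R.u3.C.scale X = j,
              (EB (fun i => g (K + 1) (i + 1)) (uB K v) X - EB (fun i => g (K + 1) (i + 1)) L.oneB X)|
            ≤ |(fam i).eTerm j' (fam i).K w|) ∧
        -- (ii-d) the dressed sub-ledger ↔ N14's bookings on `R.ne1.𝒯`
        (∀ K t, |t| ≤ S.l₀ → ∀ τ ∈ S.T K \ S.Bad K t, ∀ v ∈ Rd.dom,
          ∃ (pA : R.ne1.P) (βA : R.u3.C.Dom → (R.ne1.𝒯.B pA K).Birth) (Q : Finset (R.ne1.𝒯.B pA K).Cube) (pB : R.ne1.P)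
            (KB : ℕ) (βB : R.u3.C.Dom → (R.ne1.𝒯.B pB KB).Birth),
          (∀ X ∈ (L.fac K t τ).filter (fun X => dressed X), (R.ne1.𝒯.B pA K).birthScale (βA X) = R.u3.C.scale X) ∧
          (∀ j, Set.InjOn βA ↑(((L.fac K t τ).filter (fun X => dressed X)).filter fun X => R.u3.C.scale X = j)) ∧
          (∀ c ∈ Q, (R.ne1.𝒯.B pA K).cubeScale c = K) ∧ ((Q.card : ℝ) ≤ S.vol) ∧
          (∀ X ∈ (L.fac K t τ).filter (fun X => dressed X), ∃ c ∈ Q, βA X ∈ (R.ne1.𝒯.B pA K).feltAt c) ∧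
          (∀ X ∈ (L.fac K t τ).filter (fun X => dressed X), KB - (R.ne1.𝒯.B pB KB).birthScale (βB X) = K - R.u3.C.scale X) ∧
          (∀ X ∈ (L.fac K t τ).filter (fun X => dressed X),
            |R.u3.EA (g K) (uA K v) X - R.u3.EA (g K) L.oneA X| ≤ (R.ne1.𝒯.B pA K).size (βA X) K) ∧
          (∀ X ∈ (L.fac K t τ).filter (fun X => dressed X),
            |EB (fun i => g (K + 1) (i + 1)) (uB K v) X - EB (fun i => g (K + 1) (i + 1)) L.oneB X|
              ≤ (R.ne1.𝒯.B pB KB).size (βB X) KB)) ∧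
        -- (v′-16) N16 BY NAME: THE END's regime letters of `R.ne3`, N07's interface, the selection, NE7 route-#1's side letters, the
        -- reading map, the action-reading identification, the offset, the gauge-domination convention
        R.ne3.g = gradConst 4 c' ∧ 1 ≤ R.ne3.Nper ∧ 0 ≤ R.ne3.b ∧ 0 ≤ c' ∧ R.ne3.b ≤ t ∧ c' ≤ t ∧ 0 ≤ R.ne3.C ∧
        (2 : ℝ) ^ 91 * (R.ne3.L : ℝ) ^ 17 * t ≤ 1 ∧ (2 : ℝ) ^ 76 * (R.ne3.L : ℝ) ^ 12 * t ≤ R.ne3.ε ∧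
        16 * B7Prop2Explicit.C0 4 * R.ne3.ε ≤ 3 ∧ 1024 * (4 + 1) * (4 + 4) * (R.ne3.L : ℝ) ^ 2 * R.ne3.ε ≤ 1 ∧
        ε₁ ≤ 1 / 4 ∧ ε₁ ≤ R.ne3.b ∧ 4 * ε₁ ≤ c' ∧ R.ne3.dom ⊆ sfClass 4 R.ne3.L R.ne3.Nper ε₁ 0 ∧
        LeafH3sup 4 R.ne3.L R.ne3.Nper R.ne3.ε R.ne3.b c' R.ne3.dom ∧
        (∀ V ∈ R.ne3.dom, ∀ k : ℕ, IsMinimiser 4 (sfClass 4 R.ne3.L R.ne3.Nper R.ne3.ε) R.ne3.L R.ne3.Nper k V (sel k V)) ∧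
        (∀ V ∈ R.ne3.dom, ∀ k : ℕ, RegularSup 4 R.ne3.L R.ne3.Nper R.ne3.b c' k (sel k V)) ∧
        0 < θ ∧ θ ^ 6 = ((R.ne3.L : ℝ))⁻¹ ∧ 0 < R.ne3.Λ₂' ∧ 0 < γ₃ ∧
        R.ne3.C * (wallConst 4 R.ne3.L * (R.ne3.Nper : ℝ) ^ 2 *
          (Real.sqrt (gradConst 4 c') * dualC2 4 R.ne3.L + 2 * R.ne3.b ^ 2 * dualC1 4 R.ne3.L)) ≤ γ₃ ^ 3 ∧
        0 < l₁ ∧ R.ne3.Λ₁ ≤ l₁ ^ 3 ∧ γ₃ * θ ^ 2 ≤ l₁ * R.ne3.Nper ∧ θ ^ ((3 : ℝ) * β - 2) ≤ θ₃ ∧ θ₃ < 1 ∧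
        (∀ v ∈ Rd.dom, rd v ∈ R.ne3.dom) ∧
        (∀ k, ∀ v ∈ Rd.dom, Rd.act k v = minAct 4 (sfClass 4 R.ne3.L R.ne3.Nper R.ne3.ε) R.ne3.L R.ne3.Nper k (rd v)) ∧
        (R.ne3.Nper : ℝ) ^ 4 ≤ Rd.vol ∧ 1 ≤ k₀ ∧
        (∀ K : ℕ, ∀ v ∈ Rd.dom, ∀ (u : B7Prop1Explicit.Site 4 → (Matrix (Fin N) (Fin N) ℂ)ˣ)
          (Z : B7Prop1Explicit.Site 4 → Fin 4 → Matrix (Fin N) (Fin N) ℂ) (M : ℝ),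
          IsUnitarySite u → IsPeriodicSite u ((R.ne3.Nper * R.ne3.L ^ (k₀ + K) : ℕ) : ℤ) → T4AveragingDeficitWall.IsSkewDir Z →
          IsPeriodicDir Z ((R.ne3.Nper * R.ne3.L ^ (k₀ + K) : ℕ) : ℤ) →
          B7Prop1Explicit.gaugeAct u (sel (k₀ + K) (rd v)) =
            T4AveragingDeficitWall.vary (B7Prop2Explicit.rescale R.ne3.L (B7Prop1Explicit.bavg R.ne3.L (sel (k₀ + K + 1) (rd v)))) Z 1 →
          (∀ (x : B7Prop1Explicit.Site 4) (κ : Fin 4), (R.ne3.L : ℝ) ^ (k₀ + K) * ‖Z x κ‖ ≤ M) →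
          (∀ (x : B7Prop1Explicit.Site 4) (μ κ : Fin 4), ((R.ne3.L : ℝ) ^ (k₀ + K)) ^ 2 *
              ‖T4AveragingDeficitWall.Ad (B7Prop2Explicit.rescale R.ne3.L (B7Prop1Explicit.bavg R.ne3.L (sel (k₀ + K + 1) (rd v)))
                  (x + B7Prop1Explicit.e κ) μ) (Z (x + B7Prop1Explicit.e μ) κ) - Z x κ‖ ≤ M) →
          R.u3.C.gauge (uA K v) (R.u3.C.transport (uB K v)) ≤ M) ∧
        -- (v′-17) N17 BY NAME: the (0.20)-run identification, the infrared pin, the β-window, the smallness window, rates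
        (∀ K, RGEqH K D.βfun (g K)) ∧ (∀ K, g K K = gIR) ∧ 0 < bβ ∧
        EventualLowerH bβ R.u3.γ k₀β D.βfun ∧
        R.u3.cr * R.u3.C₉ * R.u3.ω * (((k₀β : ℝ) + 1) * R.u3.γ ^ 3 + 2 * R.u3.γ / bβ) ≤ (1 - R.u3.ρ) / 2 ∧
        0 < R.u3.ρ ∧ R.u3.ρ ≤ θc ∧
        -- the box
        (∀ K i, i ≤ K → 0 < g K i ∧ g K i ≤ R.u3.γ) ∧
        -- the bracket (T) IN THE TUBE CURRENCY (`N19LipBracketTube.lipBracket_at_rateCarriers_of_pairDisc`'s inputs): the (1.18) real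
        -- bound; the pair-disc shape at the printed tube radius κ₁·α(C₁, q₁, s_j) ((2.27)(ii)(iv) through the (1.13)∕(2.39) tube — SHAPE,
        -- NODE O); signs; the window's smallness; the UPPER running of the tables ((2.6) ∕ (0.31) upper half, β-side conditional, DISPLAYED)
        DecayBound R.u3.EA R.u3.W E₀T R.u3.κ ∧
        (∀ s ∈ R.u3.W, ∀ (X : R.u3.C.Dom) (U U' : R.u3.C.BgA),
          R.u3.C.gauge U U' < κ₁T * B14.alphaJ C₁T q₁ (s (R.u3.C.scale X)) →
          ∃ f : ℂ → ℂ, DifferentiableOn ℂ f (Metric.ball (0 : ℂ) (κ₁T * B14.alphaJ C₁T q₁ (s (R.u3.C.scale X)))) ∧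
            f 0 = (R.u3.EA s U X : ℂ) ∧ f (R.u3.C.gauge U U' : ℂ) = (R.u3.EA s U' X : ℂ) ∧
            ∀ z ∈ Metric.ball (0 : ℂ) (κ₁T * B14.alphaJ C₁T q₁ (s (R.u3.C.scale X))),
              ‖f z‖ ≤ E₀T * Real.exp (-(R.u3.κ * R.u3.C.d X))) ∧
        0 ≤ E₀T ∧ 0 < κ₁T ∧ 0 < C₁T ∧
        (∀ K j, j ≤ K → 1 / g K j ^ 2 ≤ 1 / gIR ^ 2 + β'T * ((K : ℝ) - j)) ∧ 0 ≤ β'T ∧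
        -- window memberships, selector compatibility
        (∀ K, g K ∈ R.u3.W) ∧ (∀ K, (fun i => g (K + 1) (i + 1)) ∈ R.u3.W) ∧
        (∀ s ∈ R.u3.W, 0 < bsel s ∧ bsel s ≤ R.u3.γ))

include hβ1 hlink

/-- ★★ **N19′'s EDGE GIVEN K3⁷ v2's RATES PREDICATE, MODULO THE SHORTER LINK READING** [bookkeeping]: at every guarded admissible Stage-13 tuple, every
`g₀`, `os`, run length `k`: `RatesHolderAt D R β ∧ ReadOutAt D R.u3 ∧ (0 ≤ R.u3.ρ ∧ R.u3.ρ < 1)` (= plan g79's `PHolderD4 β D R`, skeleton v2, spelled out)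
`→ ∃ δ, NE7.Core (cr …) … δ ∧ Summable δ`, for `R := rateCarriersOfRecord₁₃CoPH 𝔯 F θ hP g₀ os k`, `D := datumOfRecord₁₃CoPH F N θ hP`.  Proof: the «v9» clause of
`N19RateEdgeHolder.rateEdge_of_linkReading_byName_pairDiscC1Holder` is REASSEMBLED at the same-tuple pair predicate (spine + rate carriers pinned at ONE tuple,
the slot's `ReadOutAt` and `ρ < 1` carried INSIDE the predicate) from the shorter `hlink` and SEVEN conjuncts discharged BY NAME: `ReadOutAt D R.u3` and
`R.u3.ρ < 1` (the slot's own hypothesis), the letter signs `0 ≤ R.u3.θ ∧ 0 ≤ R.u3.C₅ ∧ 0 ≤ R.u3.ω` (dag-n19-w3 `signs_rateCarriersOfRecord₁₃CoPH_of_readOutAt`),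
`0 < R.u3.γ` (admissibility, `gamma_pos_rateCarriersOfRecord₁₃CoPH`), `2 ≤ R.ne3.L` (the family, `two_le_ne3_L_rateCarriersOfRecord₁₃CoPH`) and (T)'s window clause
`∀ s ∈ R.u3.W, ∀ j, 0 < s j ∧ s j ^ 2 ≤ e⁻¹` (from the tuple letter `θ.γ ^ 2 ≤ e⁻¹`, `window_rateCarriersOfRecord₁₃CoPH_sq_le_exp_neg_one`).  NOT NE7; N19 NOT
discharged; `hlink` (NODE O's world + the remaining in-edge letters) DISPLAYED. [folklore] -/
theorem h19HolderD4_datumOfRecord₁₃CoPH_of_linkReading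
    (F : T4Family) (θ : Stage13HParams F N) (hP : θ.Provisos₁₃CoPH F N) (hG : G θ) (hθ : θ.Admissible F N) (g₀ : ℕ → ℝ) (os : List (ULoop F)) (k : ℕ)
    (hP4 : RatesHolderAt (datumOfRecord₁₃CoPH F N θ hP) (rateCarriersOfRecord₁₃CoPH 𝔯 F θ hP g₀ os k) β ∧
      ReadOutAt (datumOfRecord₁₃CoPH F N θ hP) (rateCarriersOfRecord₁₃CoPH 𝔯 F θ hP g₀ os k).u3 ∧
      (0 ≤ (rateCarriersOfRecord₁₃CoPH 𝔯 F θ hP g₀ os k).u3.ρ ∧ (rateCarriersOfRecord₁₃CoPH 𝔯 F θ hP g₀ os k).u3.ρ < 1)) :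
    letI := (cr F θ hP g₀ os).dec
    ∃ δ : ℕ → ℝ, NE7.Core (cr F θ hP g₀ os).l₀ (cr F θ hP g₀ os).vol (cr F θ hP g₀ os).T (cr F θ hP g₀ os).Bad
      (fun K t τ => (cr F θ hP g₀ os).A K t τ - (cr F θ hP g₀ os).shA K t τ) (fun K t τ => (cr F θ hP g₀ os).B K t τ - (cr F θ hP g₀ os).shB K t τ) δ ∧
      Summable δ :=
  rateEdge_of_linkReading_byName_pairDiscC1Holder
    (fun F D g₀ os S R => ∃ (θ : Stage13HParams F N) (hP : θ.Provisos₁₃CoPH F N) (k : ℕ), G θ ∧ θ.Admissible F N ∧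
      D = datumOfRecord₁₃CoPH F N θ hP ∧ S = cr F θ hP g₀ os ∧ R = rateCarriersOfRecord₁₃CoPH 𝔯 F θ hP g₀ os k ∧ ReadOutAt D R.u3 ∧ R.u3.ρ < 1)
    hβ1 (by
      rintro F D g₀ os S R ⟨θ, hP, k, hG, hθ, rfl, rfl, rfl, hD4, hρ1⟩
      -- destructure the shorter reading IN STAGES (as the sibling E does), then reassemble v9's clause with the seven conjuncts supplied by name
      obtain ⟨hγe, iDom, F', ι', X', iMeas, L, Rd, bsel, EB, θc, θ₃, g, uA, uB, hrest⟩ := hlink F θ hP hG hθ g₀ os k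
      obtain ⟨Pf, d₀, L₀, Koff, cells, H033, I, fam, Lb, βw, κ₁, Gv, Cl, K₁, Λ₀, N₀, dressed, iDr, hrest⟩ := hrest
      obtain ⟨c', t, ε₁, ϑ, γ₃, l₁, sel, rd, k₀, gIR, bβ, k₀β, E₀T, κ₁T, C₁T, β'T, q₁, hrest⟩ := hrest
      obtain ⟨hEB, hL, hvol, homult, hCw, hΛg, hθΛ, hPd, hPL, hPK, hcard, hκ₀, hdom, hinj, hlen, hrest⟩ := hrest
      obtain ⟨h11, hβw1, hβw0, hLb, hGv, hCl, hcount, hN₀, hΛ₀, hle, hidA, hidB, hidD, hrest⟩ := hrest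
      obtain ⟨hg3, hNper, hb, hc', hbt, hct, hC3, hsmall3, hεt, hε1, hε2, hε₁, hε₁b, hε₁c, hdom3, hH3, hsel, hreg, hrest⟩ := hrest
      obtain ⟨hθ0, hθ6, hΛ₂', hγ₃, hγ3, hl₁, hΛl₁, hfit, hθ₃θ, hθ₃1, hrd, hact, hvol3, hk₀, hdomC1, hrest⟩ := hrest
      obtain ⟨hrun, hpin, hbβ, hlo, hsmallβ, hρ0, hρθc, hbox, hrest⟩ := hrest
      obtain ⟨hdecT, hdiscT, hE₀T, hκ₁T, hC₁T, hup, hβ'T, hgA, hgB, hbsel⟩ := hrest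
      have hsg := signs_rateCarriersOfRecord₁₃CoPH_of_readOutAt 𝔯 θ hP g₀ os k hD4
      refine ⟨iDom, F', ι', X', iMeas, L, Rd, bsel, EB, θc, θ₃, g, uA, uB, Pf, d₀, L₀, Koff, cells, H033, I, fam, Lb, βw, κ₁, Gv, Cl, K₁, Λ₀, N₀,
        dressed, iDr, c', t, ε₁, ϑ, γ₃, l₁, sel, rd, k₀, gIR, bβ, k₀β, E₀T, κ₁T, C₁T, β'T, q₁, hEB, hL, hvol, homult, hCw, hΛg, hθΛ, hPd, hPL, hPK,
        hcard, hκ₀, hdom, hinj, hlen, h11, hβw1, hβw0, hLb, hGv, hCl, hcount, hN₀, hΛ₀, hle, hidA, hidB, hidD, ?_⟩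
      exact ⟨hg3, two_le_ne3_L_rateCarriersOfRecord₁₃CoPH 𝔯 θ hP g₀ os k, hNper, hb, hc', hbt, hct, hC3, hsmall3, hεt, hε1, hε2, hε₁, hε₁b, hε₁c,
        hdom3, hH3, hsel, hreg, hθ0, hθ6, hΛ₂', hγ₃, hγ3, hl₁, hΛl₁, hfit, hθ₃θ, hθ₃1, hrd, hact, hvol3, hk₀, hdomC1,
        hsg.1, hsg.2.1, hsg.2.2, hrun, hpin, hD4, hbβ, hlo, hsmallβ, hρ0, hρ1, gamma_pos_rateCarriersOfRecord₁₃CoPH 𝔯 θ hP hθ g₀ os k, hρθc, hbox,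
        hdecT, hdiscT, hE₀T, hκ₁T, hC₁T, window_rateCarriersOfRecord₁₃CoPH_sq_le_exp_neg_one 𝔯 θ hP g₀ os k hγe, hup, hβ'T, hgA, hgB, hbsel⟩)
    F _ g₀ os _ _ ⟨θ, hP, k, hG, hθ, rfl, rfl, rfl, hP4.2.1, hP4.2.2.2⟩ hP4.1

/-- ★★ **K3⁷ v2's N19′ SLOT SHAPE** (`KeyedCoreEdgeHolderD4 β cr (rrOfRecord 𝔯 ks)` of plan g79's skeleton v2 145a664ea9c38a7b, UNFOLDED — the skeleton's
`def`s are local to it): for any run-length selector `ks`, at every guarded admissible tuple and every `g₀ os`, `PHolderD4 β D (rateCarriersOfRecord₁₃CoPH 𝔯 F θ hP g₀ os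
(ks F θ hP g₀ os)) → ∃ δ, NE7.Core (cr …) … δ ∧ Summable δ` — §1 at `k := ks F θ hP g₀ os`.  At `N = 2`, `G := θ.ZhUnity F 2 ∧ θ.SlotsNondegenerate₁₃ F 2` this IS the slot's
text modulo `hlink`; NOT a proof of stub 2; NOT NE7. [folklore] -/
theorem keyedCoreEdgeHolderD4_of_linkReading
    (ks : (F : T4Family) → (θ : Stage13HParams F N) → θ.Provisos₁₃CoPH F N → (ℕ → ℝ) → List (ULoop F) → ℕ)
    (F : T4Family) (θ : Stage13HParams F N) (hP : θ.Provisos₁₃CoPH F N) (hG : G θ) (hθ : θ.Admissible F N) (g₀ : ℕ → ℝ) (os : List (ULoop F))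
    (hP4 : RatesHolderAt (datumOfRecord₁₃CoPH F N θ hP) (rateCarriersOfRecord₁₃CoPH 𝔯 F θ hP g₀ os (ks F θ hP g₀ os)) β ∧
      ReadOutAt (datumOfRecord₁₃CoPH F N θ hP) (rateCarriersOfRecord₁₃CoPH 𝔯 F θ hP g₀ os (ks F θ hP g₀ os)).u3 ∧
      (0 ≤ (rateCarriersOfRecord₁₃CoPH 𝔯 F θ hP g₀ os (ks F θ hP g₀ os)).u3.ρ ∧ (rateCarriersOfRecord₁₃CoPH 𝔯 F θ hP g₀ os (ks F θ hP g₀ os)).u3.ρ < 1)) :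
    letI := (cr F θ hP g₀ os).dec
    ∃ δ : ℕ → ℝ, NE7.Core (cr F θ hP g₀ os).l₀ (cr F θ hP g₀ os).vol (cr F θ hP g₀ os).T (cr F θ hP g₀ os).Bad
      (fun K t τ => (cr F θ hP g₀ os).A K t τ - (cr F θ hP g₀ os).shA K t τ) (fun K t τ => (cr F θ hP g₀ os).B K t τ - (cr F θ hP g₀ os).shB K t τ) δ ∧
      Summable δ :=
  h19HolderD4_datumOfRecord₁₃CoPH_of_linkReading cr 𝔯 G hβ1 hlink F θ hP hG hθ g₀ os (ks F θ hP g₀ os) hP4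

end AtRecordD4


end Summit.QuantumFields.YangMills.BalabanUVNodes.N19RateEdgeHolderD4

end
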